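import Summits.AtomisticToContinuum.HydrodynamicLimit.Theorems.BoxDissipativeWeakStrongEntropyAdmissibilityDynamicCore
import Summits.AtomisticToContinuum.HydrodynamicLimit.Theorems.BoxDissipativeWeakStrongEntropyAdmissibilityStubGlobalEquilibriumEntropyBalanceHelpers
import Summits.AtomisticToContinuum.HydrodynamicLimit.Theorems.BoxDissipativeWeakStrongEntropyAdmissibilityStubStaticEntropyFunctionalsLLN
import Summits.AtomisticToContinuum.HydrodynamicLimit.Theorems.BoxDissipativeWeakStrongEntropyAdmissibilityStubTestTransportIdentity

/-!
# Crux `EntropyAdmissibility` (stmt-AtomisticToContinuum-9903), line `registered` — stub `stub_globalEquilibriumEntropyBalance`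

Registered stub GE3 of the line `registered` of the crux
`Summit.AtomisticToContinuum.HydrodynamicLimit.Theses.BoxDissipativeWeakStrong.EntropyAdmissibility`:
**GE1 → GE2 → `InFrameConst CdynAbs`**, the clamp-renormalised entropy balance at GLOBAL EQUILIBRIUM. In the
global-equilibrium sub-frame of the crux (constant profiles `a₀ ≡ ca`, `θ₀ ≡ cθ`, `u₀ ≡ cu`, so that `P_N` is the
canonical global Gibbs law of `N + 1` hard spheres; constant Euler state `(cρ, cv, cϑ)`), the DYNAMIC part
`A_N = ∫_{(0,τ]}∫(ρ̂ Z_{a,b}(ŝ) ∂ₜφ + Z_{a,b}(ŝ) m̂·∇φ) dx dt − ∫ ρ̂_τ Z_{a,b}(ŝ_τ) φ_τ dx` converges in `L¹(P_N)` to MINUS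
the initial entropy `B = ∫ cρ Z_{a,b}(s_cut(cρ, cϑ)) φ(0,x) dx`: `E_{P_N}|A_N + B| → 0` — zero entropy production at
equilibrium. Hypotheses (stubs of the same line, both meanwhile LANDED — `EABirthGE1`, `EABirthGE2` — so that the
conclusion also holds unconditionally, `inFrameConst_dynAbs`): GE1 `Sig.stub_staticEntropyFunctionalsLLN` (static laws
of large numbers at flow-time `0` for the two entropy functionals `∫ ρ̂ Z(ŝ) ψ dx`, `∫ Z(ŝ) m̂·Ψ dx`, general profiles) and
GE2 `Sig.stub_testTransportIdentity` (the deterministic identity `∫_{(0,τ]}∫(h ∂ₜφ + h v·∇φ) dx dt − ∫ h φ_τ dx + ∫ h φ_0 dx = 0`).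
Proof (measure theory only; toolbox `EABirthGE3`, file A `…GlobalEquilibriumEntropyBalanceHelpers`):
* as in S2b, `A_N = ∫_{(0,τ]} g_N(t) dt − k_N` a.s. along the regularised flow `EABirthS2b.gflow`
  (`EABirthS1a.dynPart_eq_clamp`), `g_N(t, z) = ∫ statBulk(ψ₁, ψ₂, t)(Ψ_t z, x) dx` with the time-clamped test data
  `ψ₁ = ∂ₜφ`, `ψ₂ = ∇φ`, `k_N(z) = ∫ statBdry(φ_τ)(Ψ_τ z, x) dx`;
* the global Gibbs law is INVARIANT under every hard-sphere flow (`map_flow_localGibbsLaw_const`), so the `L¹(P_N)`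
  distance of a static functional to a constant is the same at flow-time `t` as at flow-time `0` (`lintegral_map`,
  `Φ_0 = id` a.s.); hence GE1 at the constant data gives `E|g_N(t) − ḡ(t)| → 0` for EVERY `t`,
  `ḡ(t) = ∫ cρ Z ψ₁ dx + ∫ Z ⟪cρ cv, ψ₂⟫ dx`, `Z = Z_{a,b}(s_cut(cρ, cϑ))`, and `E|k_N − ∫ cρ Z φ_τ dx| → 0`;
* dominated convergence in `t` (`EABirthGE3.tendsto_lintegral_integral_sub`: joint measurability, the `N`-UNIFORM
  affine bound `|g_N(t,z)| ≤ C + D (N+1)⁻¹Σ‖vᵢ‖²` from `∫ ρ̂ dx = 1`, `∫ ‖m̂‖ dx ≤ (N+1)⁻¹Σ‖vᵢ‖`, energy conservation,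
  and the Maxwellian moment bound `E_{P_N}[(N+1)⁻¹Σ‖vᵢ‖²] ≤ K`) gives `E|∫ g_N dt − ∫ ḡ dt| → 0`;
* `∫_{(0,τ]} ḡ dt − ∫ cρ Z φ_τ dx + B = 0` is GE2 with `h = cρ Z`, `v = cv` (on `(0, τ]` the clamped data are
  `∂ₜφ`, `∇φ`; `⟪cρ cv, ·⟫ = cρ ⟪cv, ·⟫`), whence `|A_N + B| ≤ |∫ g_N dt − ∫ ḡ dt| + |k_N − ∫ cρ Z φ_τ dx|` a.s.
Thresholds: `ηc := min η₀ ηc(GE1)` (`η₀` of `HsEosLowDensity`), `σ₀ := min σ₀(GE1) (1/2)`.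

References: H. Spohn, *Large Scale Dynamics of Interacting Particles* (1991), Part I §2.3, Ch. 3; J. Březina,
E. Feireisl, J. Math. Soc. Japan 70 (2018), Def. 2.9, §3.2. prover-line-stmt-AtomisticToContinuum-9903-c2-0 (worker GE3).
-/

noncomputable section

open MeasureTheory Filter Set
open scoped ENNReal Topology

namespace Summit.AtomisticToContinuum.HydrodynamicLimit.Theorems.EABirthGE3

open Literature.MathematicalPhysics.KineticTheory
open Literature.Analysis.FluidPDE.CompressibleEuler (clamp)
open Summit.AtomisticToContinuum.HydrodynamicLimit.Theses
open Summit.AtomisticToContinuum.HydrodynamicLimit.Theorems.BDWS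
open Summit.AtomisticToContinuum.HydrodynamicLimit.Theorems.EABirthCore (Conclusion InFrame)
open Literature.Analysis.FluidPDE (Config HardSphereFlow)
open Literature.Analysis.FunctionSpaces
open EABirthS1a (statEntropy statBulk statBdry)
open EABirthS2bA (exists_lintegral_meanKinetic_le)
open EABirthS2b (gflow gflow_ae_eq measurable_gflow sum_norm_sq_gflow max_abs_pos)

/-! ## The frame, the hypotheses and the conclusion (verbatim the lead's skeleton) -/

/-- The global-equilibrium sub-frame (verbatim the skeleton's `InFrameConst`). -/
def InFrameConst (C : Conclusion) : Prop :=
  BoxDissipativeWeakStrong.HsEosLowDensity →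
    ∃ ηc : ℝ, 0 < ηc ∧ ∀ η₁ : ℝ, 0 < η₁ → η₁ < ηc →
      ∀ (ca cθ : ℝ) (cu : V3), 0 < ca → 0 < cθ →
        ∃ σ₀ : ℝ, 0 < σ₀ ∧ ∀ σ : ℝ, 0 < σ → σ < σ₀ →
          ∀ (T cρ cϑ : ℝ) (cv : V3),
            IsHardSphereEulerSolution σ T (fun _ _ => cρ) (fun _ _ => cv) (fun _ _ => cϑ) →
            (∀ t ∈ Ico 0 T, ∀ _x : T3, cρ * σ ^ 3 ≤ η₁ / 2) →
            ∀ Φ : FlowFamily σ,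
              TendstoHydroFieldsAt (fun N => localGibbsLaw σ (fun _ => ca) (fun _ => cu) (fun _ => cθ) N (Φ N)) Φ
                (fun _ _ => cρ) (fun _ _ => cv) (fun _ _ => cϑ) 0 →
              ∀ ℓ : ℕ → ℝ, (∀ N, 0 < ℓ N ∧ ℓ N ≤ 1) → Tendsto ℓ atTop (𝓝 0) →
                Tendsto (fun N : ℕ => ℓ N ^ 3 * ((N : ℝ) + 1)) atTop atTop →
                ∀ τ ∈ Ico 0 T, ∀ a b : ℝ, a < b → ∀ φ : ℝ → T3 → ℝ,
                  Literature.Analysis.FunctionSpaces.Torus.IsSmoothSpaceTimeOn (Ico 0 T) φ →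
                  (∀ t ∈ Icc 0 τ, ∀ x, 0 ≤ φ t x) →
                  C σ η₁ (fun _ => ca) (fun _ => cθ) (fun _ => cu) T (fun _ _ => cρ) (fun _ _ => cϑ) (fun _ _ => cv)
                    Φ ℓ τ a b φ

/-- GE1's conclusion (verbatim the skeleton's `Cge1`). -/
def Cge1 : Conclusion := fun σ η₁ a₀ θ₀ u₀ _T ρ θ u Φ ℓ _τ a b _φ =>
  (∀ ψ : T3 → ℝ, Continuous ψ →
    Tendsto (fun N : ℕ => ∫⁻ z, ENNReal.ofReal
        |(∫ x, boxDensity σ ℓ Φ N 0 z x * boxClampedEntropy σ η₁ ℓ Φ a b N 0 z x * ψ x) -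
          ∫ x, ρ 0 x * clamp a b (cutEntropy σ η₁ (ρ 0 x) (θ 0 x)) * ψ x|
      ∂(localGibbsLaw σ a₀ u₀ θ₀ N (Φ N))) atTop (𝓝 0)) ∧
  (∀ Ψ : T3 → V3, Continuous Ψ →
    Tendsto (fun N : ℕ => ∫⁻ z, ENNReal.ofReal
        |(∫ x, boxClampedEntropy σ η₁ ℓ Φ a b N 0 z x * inner ℝ (boxMomentum σ ℓ Φ N 0 z x) (Ψ x)) -
          ∫ x, clamp a b (cutEntropy σ η₁ (ρ 0 x) (θ 0 x)) * inner ℝ (ρ 0 x • u 0 x) (Ψ x)|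
      ∂(localGibbsLaw σ a₀ u₀ θ₀ N (Φ N))) atTop (𝓝 0))

/-- GE1's signature (verbatim). -/
def Sig.stub_staticEntropyFunctionalsLLN : Prop :=
  InFrame Cge1

/-- GE2's signature (verbatim). -/
def Sig.stub_testTransportIdentity : Prop :=
  ∀ (T τ : ℝ), τ ∈ Ico 0 T → ∀ φ : ℝ → T3 → ℝ,
    Literature.Analysis.FunctionSpaces.Torus.IsSmoothSpaceTimeOn (Ico 0 T) φ →
    ∀ (h : ℝ) (v : V3),
      (∫ t in Ioc 0 τ, ∫ x, (h * Literature.Analysis.FunctionSpaces.Torus.timeDerivWithin (Ico 0 T) φ t x +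
          h * inner ℝ v (Literature.Analysis.FunctionSpaces.Torus.gradient (φ t) x))) -
        (∫ x, h * φ τ x) + ∫ x, h * φ 0 x = 0

/-- The two-sided dynamic conclusion (verbatim the skeleton's `CdynAbs`): `E_{P_N}|A_N + B| → 0`. -/
def CdynAbs : Conclusion := fun σ η₁ a₀ θ₀ u₀ T ρ θ _u Φ ℓ τ a b φ =>
  Tendsto (fun N : ℕ => ∫⁻ z, ENNReal.ofReal |dynPart σ η₁ T ℓ Φ τ a b φ N z + initLimit σ η₁ ρ θ a b φ|
    ∂(localGibbsLaw σ a₀ u₀ θ₀ N (Φ N))) atTop (𝓝 0)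

/-- GE3's signature (verbatim the skeleton's). -/
def Sig.stub_globalEquilibriumEntropyBalance : Prop :=
  Sig.stub_staticEntropyFunctionalsLLN → Sig.stub_testTransportIdentity → InFrameConst CdynAbs

/-! ## The stub -/

/-- **Registered stub `stub_globalEquilibriumEntropyBalance` (GE3)** of the line `registered` of the crux
stmt-AtomisticToContinuum-9903: at global equilibrium the dynamic part of the clamp-renormalised entropy balance
converges in `L¹(P_N)` to minus the initial entropy, `E_{P_N}|A_N + B| → 0`, given the static LLNs GE1 and the transport
identity GE2. Thresholds: `ηc := min η₀ ηc(GE1)`, `σ₀ := min σ₀(GE1) (1/2)`. -/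
theorem stub_globalEquilibriumEntropyBalance : Sig.stub_globalEquilibriumEntropyBalance := by
  intro h1 h2 hEos
  obtain ⟨ηg, hηg, H1⟩ := h1 hEos
  obtain ⟨η₀, hη₀, F, hFan, hFeq, -⟩ := hEos
  have hcont : ContinuousOn hsExcessFreeEnergy (Ico 0 η₀) :=
    (hFan.continuousOn.mono fun η hη => ⟨(neg_lt_zero.2 hη₀).trans_le hη.1, hη.2⟩).congr hFeq
  refine ⟨min η₀ ηg, lt_min hη₀ hηg, fun η₁ hη₁ hη₁c ca cθ cu hca hcθ => ?_⟩
  have hη₁₀ : η₁ < η₀ := hη₁c.trans_le (min_le_left _ _)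
  obtain ⟨σ₁, hσ₁, G1⟩ := H1 η₁ hη₁ (hη₁c.trans_le (min_le_right _ _)) (fun _ => ca) (fun _ => cθ) (fun _ => cu)
    continuous_const continuous_const continuous_const (fun _ => hca) (fun _ => hcθ)
  refine ⟨min σ₁ (1 / 2), lt_min hσ₁ one_half_pos, ?_⟩
  intro σ hσ hσlt T cρ cϑ cv hsol hguard Φ hLLN ℓ hℓ hℓ0 hℓ3 τ hτ a b hab φ hφ hφ0
  have HG := G1 σ hσ (hσlt.trans_le (min_le_left _ _)) T (fun _ _ => cρ) (fun _ _ => cϑ) (fun _ _ => cv) hsol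
    hguard Φ hLLN ℓ hℓ hℓ0 hℓ3 τ hτ a b hab φ hφ hφ0
  -- the global Gibbs laws: probability, carried by the good sets, uniform kinetic moment
  set P : (N : ℕ) → Measure (Config (N + 1) (Fin 3) T3) :=
    fun N => localGibbsLaw σ (fun _ => ca) (fun _ => cu) (fun _ => cθ) N (Φ N)
  have hP : ∀ N, IsProbabilityMeasure (P N) := fun N =>
    isProbabilityMeasure_localGibbsLaw continuous_const continuous_const continuous_const (fun _ => hca)
      (fun _ => hcθ) (hσlt.trans_le (min_le_right _ _)).le N (Φ N)
  have hgood : ∀ N, P N (Φ N).goodᶜ = 0 := fun N => by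
    show localGibbsLaw σ (fun _ => ca) (fun _ => cu) (fun _ => cθ) N (Φ N) (Φ N).goodᶜ = 0
    rw [localGibbsLaw_eq]
    exact localGibbsMeasure_absolutelyContinuous σ _ _ _ N (Φ N) (Φ N).measure_compl_good
  obtain ⟨K, hK, hWK⟩ := exists_lintegral_meanKinetic_le (a₀ := fun _ => ca) (θ₀ := fun _ => cθ) (u₀ := fun _ => cu)
    continuous_const continuous_const continuous_const (fun _ => hca.le) (fun _ => hcθ)
  have hWK' : ∀ N, ∫⁻ z, ENNReal.ofReal (((N : ℝ) + 1)⁻¹ * ∑ i, ‖(z i).2‖ ^ 2) ∂P N ≤ ENNReal.ofReal K :=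
    fun N => hWK σ N (Φ N)
  -- test data: clamped in time to `[0, τ] ⊆ [0, T)`, continuous slices, sup bounds
  have hIcc : Icc 0 τ ⊆ Ico 0 T := fun t ht => ⟨ht.1, ht.2.trans_lt hτ.2⟩
  have hS : UniqueDiffOn ℝ (Ico 0 T) := uniqueDiffOn_Ico 0 T
  have hcl : ∀ t : ℝ, max 0 (min t τ) ∈ Icc 0 τ := fun t => ⟨le_max_left _ _, max_le hτ.1 (min_le_right _ _)⟩
  set ψ₁ : ℝ → T3 → ℝ := fun s => Torus.timeDerivWithin (Ico 0 T) φ (max 0 (min s τ)) with hψ₁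
  set ψ₂ : ℝ → T3 → V3 := fun s => Torus.gradient (φ (max 0 (min s τ))) with hψ₂
  have hψ₁c : ∀ t, Continuous (ψ₁ t) := fun t => ((hφ.timeDerivWithin hS).isSmooth_slice (hIcc (hcl t))).continuous
  have hψ₂c : ∀ t, Continuous (ψ₂ t) := fun t => ((hφ.gradient hS).isSmooth_slice (hIcc (hcl t))).continuous
  have hφτ : Continuous (φ τ) := (hφ.isSmooth_slice (hIcc ⟨hτ.1, le_rfl⟩)).continuous
  obtain ⟨D, hD⟩ := (hφ.timeDerivWithin hS).exists_norm_le_of_isCompact isCompact_Icc hIcc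
  obtain ⟨Gs, hGs⟩ := (hφ.gradient hS).exists_norm_le_of_isCompact isCompact_Icc hIcc
  have hD0 : 0 ≤ D := (norm_nonneg _).trans (hD 0 ⟨le_rfl, hτ.1⟩ 0)
  have hGs0 : 0 ≤ Gs := (norm_nonneg _).trans (hGs 0 ⟨le_rfl, hτ.1⟩ 0)
  have hM := max_abs_pos hab
  -- the limits: `Zc = Z_{a,b}(s_cut(cρ, cϑ))`, `ḡ`, `k̄`, `B`
  set Zc : ℝ := clamp a b (cutEntropy σ η₁ cρ cϑ) with hZc
  have hZcM : |Zc| ≤ max |a| |b| := Literature.Analysis.FluidPDE.CompressibleEuler.abs_clamp_le hab.le _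
  set gbar : ℝ → ℝ := fun t => (∫ x, cρ * Zc * ψ₁ t x) + ∫ x, Zc * inner ℝ (cρ • cv) (ψ₂ t x) with hgbar
  set kbar : ℝ := ∫ x, cρ * Zc * φ τ x with hkbar
  have hB : initLimit σ η₁ (fun _ _ => cρ) (fun _ _ => cϑ) a b φ = ∫ x, cρ * Zc * φ 0 x := rfl
  -- the bulk `g N t z` and the boundary `k N z` along the regularised flow
  set g : ∀ N : ℕ, ℝ → Config (N + 1) (Fin 3) T3 → ℝ := fun N t z =>
    ∫ x, statBulk σ η₁ (ℓ N) a b ψ₁ ψ₂ t (gflow (Φ N) t z) x with hg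
  set k : ∀ N : ℕ, Config (N + 1) (Fin 3) T3 → ℝ := fun N z =>
    ∫ x, statBdry σ η₁ (ℓ N) a b (φ τ) (gflow (Φ N) τ z) x with hk
  -- Step A: `L¹` convergence of the bulk at every fixed time (GE1 transferred along the invariant flow)
  have cA : ∀ t, Tendsto (fun N : ℕ => ∫⁻ z, ENNReal.ofReal |g N t z - gbar t| ∂P N) atTop (𝓝 0) := fun t =>
    tendsto_bulk hcont hσ hη₁ hη₁₀ hab hℓ hgood t (hψ₁c t) (hψ₂c t) (HG.1 (ψ₁ t) (hψ₁c t)) (HG.2 (ψ₂ t) (hψ₂c t))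
  -- Step B: the time integral (dominated convergence in `t`)
  have hbd : ∀ N t z, |g N t z| ≤ (max |a| |b| * D + max |a| |b| * Gs / 2) +
      max |a| |b| * Gs / 2 * (((N : ℝ) + 1)⁻¹ * ∑ i, ‖(z i).2‖ ^ 2) := fun N t z => by
    rw [← sum_norm_sq_gflow (Φ N) t z]
    exact abs_integral_statBulk_le (σ := σ) (η₁ := η₁) (ψ₁ := ψ₁) (ψ₂ := ψ₂) (t := t) hab.le (hℓ N).1 (hℓ N).2
      (fun x => hD _ (hcl t) x) (fun x => hGs _ (hcl t) x) (gflow (Φ N) t z)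
  have hgm : ∀ N, Measurable fun p : ℝ × Config (N + 1) (Fin 3) T3 => g N p.1 p.2 := fun N => by
    have hm₁ : Measurable fun q : ℝ × T3 => ψ₁ q.1 q.2 :=
      EABirthS1a.measurable_clampTime (hφ.timeDerivWithin hS).continuousOn_stLift hτ.1 hIcc
    have hm₂ : Measurable fun q : ℝ × T3 => ψ₂ q.1 q.2 :=
      EABirthS1a.measurable_clampTime (u := fun s => Torus.gradient (φ s)) (hφ.gradient hS).continuousOn_stLift hτ.1 hIcc
    have h3 := EABirthS1a.measurable_statBulk (EABirthS1a.measurable_statEntropy (N := N) hcont hσ.le hη₁.le hη₁₀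
      (hℓ N).1.le a b) hm₁ hm₂
    exact ((h3.comp ((measurable_fst.comp measurable_fst).prodMk ((measurable_gflow (Φ N)).comp measurable_fst)
      |>.prodMk measurable_snd)).stronglyMeasurable.integral_prod_right').measurable
  have hgbar_m : Measurable gbar := by
    have hm₁ : Measurable fun q : ℝ × T3 => ψ₁ q.1 q.2 :=
      EABirthS1a.measurable_clampTime (hφ.timeDerivWithin hS).continuousOn_stLift hτ.1 hIcc
    have hm₂ : Measurable fun q : ℝ × T3 => ψ₂ q.1 q.2 :=
      EABirthS1a.measurable_clampTime (u := fun s => Torus.gradient (φ s)) (hφ.gradient hS).continuousOn_stLift hτ.1 hIcc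
    have e1 : Measurable fun q : ℝ × T3 => cρ * Zc * ψ₁ q.1 q.2 := hm₁.const_mul _
    have e2 : Measurable fun q : ℝ × T3 => Zc * inner ℝ (cρ • cv) (ψ₂ q.1 q.2) := (measurable_const.inner hm₂).const_mul _
    exact (e1.stronglyMeasurable.integral_prod_right' (ν := volume)).measurable.add
      (e2.stronglyMeasurable.integral_prod_right' (ν := volume)).measurable
  have hgbar_bd : ∀ t, |gbar t| ≤ |cρ| * max |a| |b| * D + max |a| |b| * ‖cρ • cv‖ * Gs := fun t => by
    have b1 : ‖∫ x, cρ * Zc * ψ₁ t x‖ ≤ |cρ| * max |a| |b| * D := by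
      have h := norm_integral_le_of_norm_le_const (μ := (volume : Measure T3)) (C := |cρ| * max |a| |b| * D)
        (f := fun x => cρ * Zc * ψ₁ t x) (Eventually.of_forall fun x => by
          rw [norm_mul, norm_mul, Real.norm_eq_abs, Real.norm_eq_abs]
          exact mul_le_mul (mul_le_mul_of_nonneg_left hZcM (abs_nonneg _)) (hD _ (hcl t) x) (norm_nonneg _)
            (by positivity))
      simpa only [probReal_univ, mul_one] using h
    have b2 : ‖∫ x, Zc * inner ℝ (cρ • cv) (ψ₂ t x)‖ ≤ max |a| |b| * ‖cρ • cv‖ * Gs := by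
      have h := norm_integral_le_of_norm_le_const (μ := (volume : Measure T3)) (C := max |a| |b| * ‖cρ • cv‖ * Gs)
        (f := fun x => Zc * inner ℝ (cρ • cv) (ψ₂ t x)) (Eventually.of_forall fun x => by
          rw [Real.norm_eq_abs, abs_mul, mul_assoc]
          exact mul_le_mul hZcM ((abs_real_inner_le_norm _ _).trans (mul_le_mul_of_nonneg_left (hGs _ (hcl t) x)
            (norm_nonneg _))) (abs_nonneg _) hM.le)
      simpa only [probReal_univ, mul_one] using h
    rw [← Real.norm_eq_abs]
    exact (norm_add_le _ _).trans (add_le_add b1 b2)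
  obtain ⟨hint, hbulk⟩ := tendsto_lintegral_integral_sub P hP (volume.restrict (Ioc 0 τ)) (g := g) (m := gbar) hgm
    (fun N => by fun_prop) (fun N z => by positivity) hWK' (by positivity) (by positivity) hK hbd hgbar_m hgbar_bd
    (ae_of_all _ cA)
  -- Step C: the boundary term
  have hbdry : Tendsto (fun N : ℕ => ∫⁻ z, ENNReal.ofReal |k N z - kbar| ∂P N) atTop (𝓝 0) :=
    tendsto_bdry hcont hσ hη₁ hη₁₀ hℓ hgood hφτ τ (HG.1 (φ τ) hφτ)
  -- Step D: the deterministic identity (GE2 with `h = cρ Zc`, `v = cv`)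
  have hAbar : (∫ t in Ioc 0 τ, gbar t) = ∫ t in Ioc 0 τ, ∫ x, (cρ * Zc * Torus.timeDerivWithin (Ico 0 T) φ t x +
      cρ * Zc * inner ℝ cv (Torus.gradient (φ t) x)) := by
    refine setIntegral_congr_fun measurableSet_Ioc fun t ht => ?_
    have ht' : t ∈ Ico 0 T := ⟨ht.1.le, ht.2.trans_lt hτ.2⟩
    have hc1 : Continuous (Torus.timeDerivWithin (Ico 0 T) φ t) := ((hφ.timeDerivWithin hS).isSmooth_slice ht').continuous
    have hc2 : Continuous (Torus.gradient (φ t)) := ((hφ.gradient hS).isSmooth_slice ht').continuous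
    have i1 : Integrable (fun x => cρ * Zc * Torus.timeDerivWithin (Ico 0 T) φ t x) :=
      integrable_of_continuous_T3 (continuous_const.mul hc1)
    have i2 : Integrable (fun x => Zc * inner ℝ (cρ • cv) (Torus.gradient (φ t) x)) :=
      integrable_of_continuous_T3 (continuous_const.mul (continuous_const.inner hc2))
    simp only [hgbar, hψ₁, hψ₂, min_eq_left ht.2, max_eq_right ht.1.le]
    rw [← integral_add i1 i2]
    refine integral_congr_ae (ae_of_all _ fun x => ?_)
    simp only [real_inner_smul_left]
    ring
  have hD : (∫ t in Ioc 0 τ, gbar t) - kbar + initLimit σ η₁ (fun _ _ => cρ) (fun _ _ => cϑ) a b φ = 0 := by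
    rw [hAbar, hB]
    exact h2 T τ hτ φ hφ (cρ * Zc) cv
  -- Step E: assembly, `|A_N + B| ≤ |∫ g_N dt − ∫ ḡ dt| + |k_N − k̄|` almost surely
  have hfin : Tendsto (fun N : ℕ => (∫⁻ z, ENNReal.ofReal |(∫ t in Ioc 0 τ, g N t z) - ∫ t in Ioc 0 τ, gbar t| ∂P N) +
      ∫⁻ z, ENNReal.ofReal |k N z - kbar| ∂P N) atTop (𝓝 0) := by
    simpa only [add_zero] using hbulk.add hbdry
  refine tendsto_of_tendsto_of_tendsto_of_le_of_le' tendsto_const_nhds hfin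
    (Eventually.of_forall fun N => bot_le) (Eventually.of_forall fun N => ?_)
  have hmeas : AEMeasurable (fun z => ENNReal.ofReal |(∫ t in Ioc 0 τ, g N t z) - ∫ t in Ioc 0 τ, gbar t|) (P N) :=
    (continuous_abs.measurable.comp_aemeasurable
      ((hint N).aestronglyMeasurable.aemeasurable.sub aemeasurable_const)).ennreal_ofReal
  calc (∫⁻ z, ENNReal.ofReal |dynPart σ η₁ T ℓ Φ τ a b φ N z + initLimit σ η₁ (fun _ _ => cρ) (fun _ _ => cϑ) a b φ| ∂P N)
      ≤ ∫⁻ z, (ENNReal.ofReal |(∫ t in Ioc 0 τ, g N t z) - ∫ t in Ioc 0 τ, gbar t| +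
          ENNReal.ofReal |k N z - kbar|) ∂P N := lintegral_mono_ae ?_
    _ = _ := lintegral_add_left' hmeas _
  filter_upwards [gflow_ae_eq (Φ N) (hgood N)] with z hz
  rw [← ENNReal.ofReal_add (abs_nonneg _) (abs_nonneg _)]
  refine ENNReal.ofReal_le_ofReal ?_
  have hAz : dynPart σ η₁ T ℓ Φ τ a b φ N z = (∫ t in Ioc 0 τ, g N t z) - k N z := by
    rw [EABirthS1a.dynPart_eq_clamp]
    simp only [← hz, hk, hg]
    rfl
  rw [hAz]
  calc |(∫ t in Ioc 0 τ, g N t z) - k N z + initLimit σ η₁ (fun _ _ => cρ) (fun _ _ => cϑ) a b φ|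
      = |((∫ t in Ioc 0 τ, g N t z) - ∫ t in Ioc 0 τ, gbar t) - (k N z - kbar)| := by
        congr 1; linarith [hD]
    _ ≤ |(∫ t in Ioc 0 τ, g N t z) - ∫ t in Ioc 0 τ, gbar t| + |k N z - kbar| := abs_sub _ _

/-! ## Both hypotheses have landed: the global-equilibrium entropy balance, unconditionally -/

/-- **The global-equilibrium entropy balance, unconditionally**: `InFrameConst CdynAbs` — at global equilibrium
`E_{P_N}|A_N + B| → 0` — from GE3 applied to the LANDED stubs GE1 (`EABirthGE1.stub_staticEntropyFunctionalsLLN`) and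
GE2 (`EABirthGE2.stub_testTransportIdentity`), whose signatures are definitionally the two hypotheses (both files paste
the skeleton's `Cge1` / transport identity verbatim). -/
theorem inFrameConst_dynAbs : InFrameConst CdynAbs :=
  stub_globalEquilibriumEntropyBalance EABirthGE1.stub_staticEntropyFunctionalsLLN EABirthGE2.stub_testTransportIdentity

end Summit.AtomisticToContinuum.HydrodynamicLimit.Theorems.EABirthGE3

end
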